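import Summits.CriticalPhenomena.PercolationContinuityZ3.Theorems.PercNearOneGluingNoHeavyLowerTailFrontierDecRowsClusterBHK3QuantIff
import HarnessLib

/-!
# `NoHeavyLowerTail` (stmt-CriticalPhenomena-4575) — Conjecture G⁺ in PROBABILITY NORMAL FORM: seven plain products, no `E₃`, no covariances

Support file (prover prim-facecert gen 12; `--supports stmt-CriticalPhenomena-4575`).  No definitions, no named facts, no sorries.

For ANY probability measure `μ` and events `D, A, B` (write `U = Dᶜ`), Sahi's third-order functional (tree `sahiE3`) of the complemented triple
satisfies the exact identity (`sahiE3_sep_compl_compl_eq_probForm`; seven atoms + `ring`)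

  `E₃(D, Aᶜ, Bᶜ) = μ(D∩A∩B) + μ(D)·μ(U∩A)·μ(U∩B) + μ(U)·μ(D∩Aᶜ∩Bᶜ)`
  `                 − (1 + μ(U))·μ(D∩A)·μ(D∩B) − μ(U)·[μ(U∩A)·μ(D∩B) + μ(U∩B)·μ(D∩A)] − μ(D)·μ(U∩Aᶜ∩Bᶜ)`.

Hence (`FrontierDecRows.clusterBHK3Pos_iff_probForm`) prim-ineq-prove-3's Conjecture G⁺ (`FrontierDecRows.ClusterBHK3Pos`, which implies the
open four-point dec rows 36/44/15/12/27/30) is EQUIVALENT to the following statement with only plain probabilities of cylinder-type events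
(`D = {S ↮ T}`, `U = {S ↔ T}`, `A` cluster-monotone in `C_S`, `B` cluster-monotone in `C_T`, every finite weighted graph):

  `(1 + μ(U))·μ(D∩A)μ(D∩B) + μ(U)·[μ(U∩A)μ(D∩B) + μ(U∩B)μ(D∩A)] + μ(D)·μ(U∩Aᶜ∩Bᶜ)`
  `      ≤ μ(D∩A∩B) + μ(D)·μ(U∩A)μ(U∩B) + μ(U)·μ(D∩Aᶜ∩Bᶜ)`.

Read with three independent copies `(ω₁, ω₂, ω₃)` this is ONE counting inequality between seven three-copy profile classes
(`#{ω₁∈D∩A, ω₂∈D∩B} + #{ω₁∈U, ω₂∈D∩A, ω₃∈D∩B} + …`), i.e. the form in which the comb / two-copy-injection programmes (prim-bnk, lead PA-BERN)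
state their targets; the earlier equivalent forms (quantitative BHK `Δ* ≤ μ(D)H' + Cov·Cov`, p323387/p323859; `(F4)/(F7)/(F8)/(G)` of the
INEQ-CLAIMS record) all carry covariances or the BHK deficit.  For the PATH row (`S={a}, T={b}, A={a↔c}, B={b↔y}`) the normal form reads
`(1+u)·P(a|b, a~c)P(a|b, b~y) + u·[P(abc)P(a|b, b~y) + P(aby)P(a|b, a~c)] + m·P(a~b, a≁c, b≁y) ≤ P(a|b, a~c, b~y) + m·P(abc)P(aby) + u·P(a≁b, a≁c, b≁y)`
(`u = P(a~b)`, `m = 1 − u`).  Numerically (prim-facecert gen 12 memo FINDING-gen12, exact rationals): identity checked on 40 random five-vertex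
instances before formalisation; equality holds on the two-edge star.
-/

noncomputable section

namespace Summit.CriticalPhenomena.PercolationContinuityZ3.Theorems

namespace CovTrianglePath

open MeasureTheory Set
open Literature.Probability.LatticeModels (sahiE3)

/-- **Probability normal form of `E₃(D, Aᶜ, Bᶜ)`** (any probability measure; `Dᶜ` plays the rôle of `U`):
`E₃(D,Aᶜ,Bᶜ) = μ(D∩A∩B) + μ(D)μ(Dᶜ∩A)μ(Dᶜ∩B) + μ(Dᶜ)μ(D∩Aᶜ∩Bᶜ) − (1+μ(Dᶜ))μ(D∩A)μ(D∩B) − μ(Dᶜ)[μ(Dᶜ∩A)μ(D∩B) + μ(Dᶜ∩B)μ(D∩A)] − μ(D)μ(Dᶜ∩Aᶜ∩Bᶜ)`.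
[this work] -/
theorem sahiE3_sep_compl_compl_eq_probForm {Ω : Type*} [MeasurableSpace Ω] (μ : Measure Ω) [IsProbabilityMeasure μ]
    {D A B : Set Ω} (hD : MeasurableSet D) (hA : MeasurableSet A) (hB : MeasurableSet B) :
    sahiE3 μ D Aᶜ Bᶜ =
      μ.real (D ∩ A ∩ B) + μ.real D * (μ.real (Dᶜ ∩ A) * μ.real (Dᶜ ∩ B)) +
          μ.real Dᶜ * μ.real (D ∩ Aᶜ ∩ Bᶜ) -
        (1 + μ.real Dᶜ) * (μ.real (D ∩ A) * μ.real (D ∩ B)) -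
        μ.real Dᶜ * (μ.real (Dᶜ ∩ A) * μ.real (D ∩ B) + μ.real (Dᶜ ∩ B) * μ.real (D ∩ A)) -
        μ.real D * μ.real (Dᶜ ∩ Aᶜ ∩ Bᶜ) := by
  -- atoms: d = μD, μ(D∩A), μ(Dᶜ∩A), μ(D∩B), μ(Dᶜ∩B), μ(D∩A∩B), μ(Dᶜ∩A∩B)
  have eU : μ.real Dᶜ = 1 - μ.real D := probReal_compl_eq_one_sub hD
  have eAc : μ.real Aᶜ = 1 - μ.real A := probReal_compl_eq_one_sub hA
  have eBc : μ.real Bᶜ = 1 - μ.real B := probReal_compl_eq_one_sub hB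
  have eA : μ.real A = μ.real (D ∩ A) + μ.real (Dᶜ ∩ A) := by
    have h := measureReal_inter_add_sdiff (μ := μ) (s := A) hD
    rw [Set.sdiff_eq, Set.inter_comm A D, Set.inter_comm A Dᶜ] at h
    linarith
  have eB : μ.real B = μ.real (D ∩ B) + μ.real (Dᶜ ∩ B) := by
    have h := measureReal_inter_add_sdiff (μ := μ) (s := B) hD
    rw [Set.sdiff_eq, Set.inter_comm B D, Set.inter_comm B Dᶜ] at h
    linarith
  have eAB : μ.real (A ∩ B) = μ.real (D ∩ A ∩ B) + μ.real (Dᶜ ∩ A ∩ B) := by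
    have h := measureReal_inter_add_sdiff (μ := μ) (s := A ∩ B) hD
    rw [Set.sdiff_eq, Set.inter_comm (A ∩ B) D, Set.inter_comm (A ∩ B) Dᶜ, ← Set.inter_assoc, ← Set.inter_assoc] at h
    linarith
  have eAcBc : μ.real (Aᶜ ∩ Bᶜ) = μ.real Aᶜ - μ.real (Aᶜ ∩ B) := by
    have h := measureReal_inter_add_sdiff (μ := μ) (s := Aᶜ) hB
    rw [Set.sdiff_eq] at h
    linarith
  have eAcB : μ.real (Aᶜ ∩ B) = μ.real B - μ.real (A ∩ B) := by
    have h := measureReal_inter_add_sdiff (μ := μ) (s := B) hA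
    rw [Set.sdiff_eq, Set.inter_comm B A, Set.inter_comm B Aᶜ] at h
    linarith
  have eDAcBc : μ.real (D ∩ Aᶜ ∩ Bᶜ) = μ.real (D ∩ Aᶜ) - μ.real (D ∩ Aᶜ ∩ B) := by
    have h := measureReal_inter_add_sdiff (μ := μ) (s := D ∩ Aᶜ) hB
    rw [Set.sdiff_eq] at h
    linarith
  have eDAc : μ.real (D ∩ Aᶜ) = μ.real D - μ.real (D ∩ A) := by
    have h := measureReal_inter_add_sdiff (μ := μ) (s := D) hA
    rw [Set.sdiff_eq] at h
    linarith
  have eDAcB : μ.real (D ∩ Aᶜ ∩ B) = μ.real (D ∩ B) - μ.real (D ∩ A ∩ B) := by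
    have h := measureReal_inter_add_sdiff (μ := μ) (s := D ∩ B) hA
    rw [Set.sdiff_eq, Set.inter_right_comm D B A, Set.inter_right_comm D B Aᶜ] at h
    linarith
  have eDBc : μ.real (D ∩ Bᶜ) = μ.real D - μ.real (D ∩ B) := by
    have h := measureReal_inter_add_sdiff (μ := μ) (s := D) hB
    rw [Set.sdiff_eq] at h
    linarith
  have eUAcBc : μ.real (Dᶜ ∩ Aᶜ ∩ Bᶜ) = μ.real (Dᶜ ∩ Aᶜ) - μ.real (Dᶜ ∩ Aᶜ ∩ B) := by
    have h := measureReal_inter_add_sdiff (μ := μ) (s := Dᶜ ∩ Aᶜ) hB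
    rw [Set.sdiff_eq] at h
    linarith
  have eUAc : μ.real (Dᶜ ∩ Aᶜ) = μ.real Dᶜ - μ.real (Dᶜ ∩ A) := by
    have h := measureReal_inter_add_sdiff (μ := μ) (s := Dᶜ) hA
    rw [Set.sdiff_eq] at h
    linarith
  have eUAcB : μ.real (Dᶜ ∩ Aᶜ ∩ B) = μ.real (Dᶜ ∩ B) - μ.real (Dᶜ ∩ A ∩ B) := by
    have h := measureReal_inter_add_sdiff (μ := μ) (s := Dᶜ ∩ B) hA
    rw [Set.sdiff_eq, Set.inter_right_comm Dᶜ B A, Set.inter_right_comm Dᶜ B Aᶜ] at h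
    linarith
  unfold sahiE3
  rw [eDAcBc, eDAc, eDAcB, eDBc, eUAcBc, eUAc, eUAcB, eAcBc, eAcB, eAc, eBc, eAB, eA, eB, eU]
  ring

/-- **`0 ≤ E₃(D, Aᶜ, Bᶜ)` ⟺ the seven-term probability inequality** (any probability measure). [this work] -/
theorem sahiE3_sep_compl_compl_nonneg_iff_probForm {Ω : Type*} [MeasurableSpace Ω] (μ : Measure Ω) [IsProbabilityMeasure μ]
    {D A B : Set Ω} (hD : MeasurableSet D) (hA : MeasurableSet A) (hB : MeasurableSet B) :
    0 ≤ sahiE3 μ D Aᶜ Bᶜ ↔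
      (1 + μ.real Dᶜ) * (μ.real (D ∩ A) * μ.real (D ∩ B)) +
            μ.real Dᶜ * (μ.real (Dᶜ ∩ A) * μ.real (D ∩ B) + μ.real (Dᶜ ∩ B) * μ.real (D ∩ A)) +
          μ.real D * μ.real (Dᶜ ∩ Aᶜ ∩ Bᶜ) ≤
        μ.real (D ∩ A ∩ B) + μ.real D * (μ.real (Dᶜ ∩ A) * μ.real (Dᶜ ∩ B)) +
          μ.real Dᶜ * μ.real (D ∩ Aᶜ ∩ Bᶜ) := by
  rw [sahiE3_sep_compl_compl_eq_probForm μ hD hA hB]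
  constructor <;> intro h <;> linarith

end CovTrianglePath

namespace FrontierDecRows

open MeasureTheory Set
open Literature.Probability.Percolation Literature.Probability.LatticeModels
open CovTrianglePath

/-- **Conjecture G⁺ in probability normal form** (kernel equivalence): `ClusterBHK3Pos` holds iff for every finite weighted graph, all terminal sets
`S, T`, every `A` cluster-monotone in `C_S` and `B` cluster-monotone in `C_T`, with `D = {S ↮ T}`:
`(1+μ(Dᶜ))μ(D∩A)μ(D∩B) + μ(Dᶜ)[μ(Dᶜ∩A)μ(D∩B) + μ(Dᶜ∩B)μ(D∩A)] + μ(D)μ(Dᶜ∩Aᶜ∩Bᶜ) ≤ μ(D∩A∩B) + μ(D)μ(Dᶜ∩A)μ(Dᶜ∩B) + μ(Dᶜ)μ(D∩Aᶜ∩Bᶜ)`.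
[this work] -/
theorem clusterBHK3Pos_iff_probForm :
    ClusterBHK3Pos ↔
      ∀ (n : ℕ) (w : Sym2 (Fin n) → unitInterval) (S T : Set (Fin n)) (A B : Set (BondConfig (Fin n))),
        (∀ ⦃ω ω' : BondConfig (Fin n)⦄,
            (⋃ s ∈ S, openEdgeCluster ω s) ⊆ (⋃ s ∈ S, openEdgeCluster ω' s) → ω ∈ A → ω' ∈ A) →
        (∀ ⦃ω ω' : BondConfig (Fin n)⦄,
            (⋃ t ∈ T, openEdgeCluster ω t) ⊆ (⋃ t ∈ T, openEdgeCluster ω' t) → ω ∈ B → ω' ∈ B) →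
        (1 + (prodBernoulli w).real {ω : BondConfig (Fin n) | ∀ s ∈ S, ∀ t ∈ T, ¬ (openGraph ω).Reachable s t}ᶜ) *
              ((prodBernoulli w).real ({ω : BondConfig (Fin n) | ∀ s ∈ S, ∀ t ∈ T, ¬ (openGraph ω).Reachable s t} ∩ A) *
                (prodBernoulli w).real ({ω : BondConfig (Fin n) | ∀ s ∈ S, ∀ t ∈ T, ¬ (openGraph ω).Reachable s t} ∩ B)) +
            (prodBernoulli w).real {ω : BondConfig (Fin n) | ∀ s ∈ S, ∀ t ∈ T, ¬ (openGraph ω).Reachable s t}ᶜ *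
              ((prodBernoulli w).real ({ω : BondConfig (Fin n) | ∀ s ∈ S, ∀ t ∈ T, ¬ (openGraph ω).Reachable s t}ᶜ ∩ A) *
                  (prodBernoulli w).real ({ω : BondConfig (Fin n) | ∀ s ∈ S, ∀ t ∈ T, ¬ (openGraph ω).Reachable s t} ∩ B) +
                (prodBernoulli w).real ({ω : BondConfig (Fin n) | ∀ s ∈ S, ∀ t ∈ T, ¬ (openGraph ω).Reachable s t}ᶜ ∩ B) *
                  (prodBernoulli w).real ({ω : BondConfig (Fin n) | ∀ s ∈ S, ∀ t ∈ T, ¬ (openGraph ω).Reachable s t} ∩ A)) +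
            (prodBernoulli w).real {ω : BondConfig (Fin n) | ∀ s ∈ S, ∀ t ∈ T, ¬ (openGraph ω).Reachable s t} *
              (prodBernoulli w).real
                ({ω : BondConfig (Fin n) | ∀ s ∈ S, ∀ t ∈ T, ¬ (openGraph ω).Reachable s t}ᶜ ∩ Aᶜ ∩ Bᶜ) ≤
          (prodBernoulli w).real ({ω : BondConfig (Fin n) | ∀ s ∈ S, ∀ t ∈ T, ¬ (openGraph ω).Reachable s t} ∩ A ∩ B) +
              (prodBernoulli w).real {ω : BondConfig (Fin n) | ∀ s ∈ S, ∀ t ∈ T, ¬ (openGraph ω).Reachable s t} *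
                ((prodBernoulli w).real ({ω : BondConfig (Fin n) | ∀ s ∈ S, ∀ t ∈ T, ¬ (openGraph ω).Reachable s t}ᶜ ∩ A) *
                  (prodBernoulli w).real ({ω : BondConfig (Fin n) | ∀ s ∈ S, ∀ t ∈ T, ¬ (openGraph ω).Reachable s t}ᶜ ∩ B)) +
            (prodBernoulli w).real {ω : BondConfig (Fin n) | ∀ s ∈ S, ∀ t ∈ T, ¬ (openGraph ω).Reachable s t}ᶜ *
              (prodBernoulli w).real
                ({ω : BondConfig (Fin n) | ∀ s ∈ S, ∀ t ∈ T, ¬ (openGraph ω).Reachable s t} ∩ Aᶜ ∩ Bᶜ) := by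
  constructor
  · intro hG n w S T A B hA hB
    exact (sahiE3_sep_compl_compl_nonneg_iff_probForm (prodBernoulli w) MeasurableSet.of_discrete MeasurableSet.of_discrete
      MeasurableSet.of_discrete).mp (hG n w S T A B hA hB)
  · intro hP n w S T A B hA hB
    exact (sahiE3_sep_compl_compl_nonneg_iff_probForm (prodBernoulli w) MeasurableSet.of_discrete MeasurableSet.of_discrete
      MeasurableSet.of_discrete).mpr (hP n w S T A B hA hB)

end FrontierDecRows

end Summit.CriticalPhenomena.PercolationContinuityZ3.Theorems
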